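import Summits.ABC.IUTFork.Repair.CandInternal2RealLabelsLicence
import HarnessLib

/-!
# IUT REPAIR branch → R-H (D-0079 «local-height condition I06⋆»), part 2: the REAL I06⋆ cells JOINED to the (xi-f) licence and to
# branch C's S_H antecedent AT THE GENUINE `K`-LEVEL DATUM `Cor312Prov.pilotDataOfK D K` (REALISING ideles, all bad fibres uniformly tame)

PROOF-ONLY k2-engine file (D-0012: 0 definitions, 0 `Prop` facts, no instance, no notation) of the abc-iut cell, rung LADDER-ABC:A2.RESCUE.H;
seat abc-iut-w5-d068 gen 6 (plan/rescue/R-H/START-HERE.md v1 §6 «k2 hands»; claim «RH-TAME-JOIN», part 2). TAKES NO SIDE on [IUTchIII]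
Cor. 3.12 or on any author; RP-I06⋆ is abc-iut-rp-d2's CANDIDATE READING (a bound hypothesis, never asserted); typed ≠ proved; instantiated ≠
endorsed; refuted-as-typed ≠ refuted-in-print.

Part 1 (`CandInternal2RealLabelsLicence`) proves, over a GENERIC Dupuy–Hilado datum `X` with integer idele exponents, the sandwich «REAL I06⋆
cell `t_{q,w} ∈ t_{q,w}^{j²}·ℐ_{K_w}` (abc-iut-rp-d2 `CandInternal2RealLabels`, p450037) ⟹ (xi-f) licence cell at `(j, p)` ⟹ LINEAR shell cell
`t_{q,w} ∈ t_{q,w}^{j}·ℐ_{K_w}`» on uniformly TAME fibres. THIS FILE reads it at the GENUINE `K`-level datum of branch C's window certificates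
(`Conditional.abc_of_SH_v8K_window` p444039 / `v10K` p447945: bed `settingPrVolSharp (pilotDataOfK T.D T.K) …`) for Θ- and q-ideles REALISING the
pilot divisors (abc-iut-w5-d236's `ht` / `htq` binders; [IUTchI] Ex. 3.2 (iv) makes the q-degree `P_w = e(w|v)·ord_v(q_v)/(2l)` a positive
integer, abc-iut-C-cert `Cor312Prov.exists_nat_qPilot_pilotDataOfK`), through abc-iut-w5-d009's exact all-tame decision
`Cor312Prov.licence_settingPrVolSharp_pilotDataOfK_iff_of_tame` (`Cor312LicenceTameExactGenuineK`).

WHAT IS PROVED (namespace `Summit.ABC.IUTFork.Repair.CandInternal2RealLabelsLicenceGenuineK`; everything consumed BY NAME):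
* **`licence_settingPrVolSharp_pilotDataOfK_of_realStar_tame`** — at a genuine datum whose bad fibres are uniformly tame (`p > 2`,
  `e(x|p) = e_p ≤ p − 2`), REALISING ideles: «the real I06⋆ cell at every bad place `w` and every label `j ∈ 𝔽_l^⋇`» ⟹ abc-iut-c312-1's
  `Thm311ToCor312.Licence` at `settingPrVolSharp (pilotDataOfK D K) …`;
* **`exists_qPinned_and_hull_settingPrVolSharp_pilotDataOfK_of_realStar_tame`** — … ⟹ branch C's PER-DATUM S_H antecedent
  «∃ ρ qK, QPinned ∧ PilotKummerCompatHull» (any columns `col`): the (k2) target shape of plan/rescue/R-H/START-HERE.md §3, reached from the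
  I06⋆ column block on the tame stratum;
* **`realLinear_of_licence_settingPrVolSharp_pilotDataOfK_tame`** — conversely the licence at such a datum forces the LINEAR shell cell
  `t_{q,w} ∈ t_{q,w}^{j}·ℐ_{K_w}` at every bad place and label (necessity: abc-iut-w5-d009's `necessary_leg_of_tame_exact`).

READING FOR THE I06⋆ COLUMN BLOCK (START-HERE §2; neutral, arithmetic): on rows of stratum `tame`, `i06star_datum = POS` ⟹ R-W verdict
INHABITED for the licence / S_H antecedent (this file), and R-W verdict INHABITED ⟹ every LINEAR cell `(j−1)·P_w ≤ e_p − 1` holds; the converse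
of neither implication holds in general (part 1 `int_sandwich_strict`). HONEST SCOPE (binding, abc-iut-w4-d026's / w5-d009's): OUR sharp
containers (Θ-regions constant in `m`), Dupuy–Hilado's typed (Ind1)/(Ind2) acting independently on every (capsule slot, place); the hull-level
licence is a STRONGER-THAN-PRINT form of Step (xi-f); nothing about the printed GLOBAL inequality or the NUMBER-level corollary
`Cor22.Cor312AtDatum`; wild / boundary bad places are outside this file; nothing asserts or refutes [IUTchIII] Cor. 3.12.
[cite: Mochizuki2012, IUTchI Def. 3.1 (b),(c) pp. 61–62, Ex. 3.2 (iv) p. 71; IUTchIII Cor. 3.12 p. 173–174, Step (xi-f) p. 184; IUTchIV Prop. 1.2 (i)(ii) p. 10]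
[cite: MochizukiAbsTopIII2015, Def 5.4 (iii) p. 126] [cite: DupuyHilado2025, §3.3, §3.4, §3.9, §4.9] [cite: ScholzeStix2018, §2.2 pp. 9–10]
[claim: Mochizuki2012, status: disputed] for every IUT sentence quoted. Axioms: standard.
-/

noncomputable section

open Set Metric Function NumberField IsDedekindDomain
open scoped Pointwise

namespace Summit.ABC.IUTFork.Repair.CandInternal2RealLabelsLicenceGenuineK

open Literature.AnabelianGeometry.AbsoluteAnabelian Literature.IUT.LogThetaLattice Literature.IUT.LogVolume
  Literature.IUT.HodgeTheaters Literature.NumberTheory.NumberFields Literature.NumberTheory.GaloisRepresentations.Ultrametric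
open Summit.ABC.IUTFork.Thm311 Summit.ABC.IUTFork.Thm311.Real Summit.ABC.IUTFork.Cor312 Summit.ABC.IUTFork.Cor312.Setting
  Summit.ABC.IUTFork.Cor312Vol Summit.ABC.IUTFork.Cor312Prov Summit.ABC.IUTFork.Repair.CandInternal2RealLabels
  Summit.ABC.IUTFork.Repair.CandInternal2RealLabelsLicence

variable {F K Fbar : Type} [Field F] [NumberField F] [Field K] [NumberField K] [Algebra F K] [Field Fbar]
  [Algebra F Fbar] [Algebra K Fbar] {E : WeierstrassCurve F} [E.IsElliptic] {l : ℕ} {Pb : BadPlacePredicates K}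
  (D : InitialThetaData F K Fbar E l Pb) {logv : PadicLogs K} (hlog : LogvAnalytic logv)
  (M : Type) [Field M] [NumberField M]
  (archPk : ∀ (j : (thetaIndex (pilotDataOfK D K)).Label) (vQ : (thetaIndex (pilotDataOfK D K)).VQ),
    Set ((logShellsDH (pilotDataOfK D K) logv).Packet j vQ))
  (archSub : ∀ (j : (thetaIndex (pilotDataOfK D K)).Label) (v : (thetaIndex (pilotDataOfK D K)).V),
    Set ((logShellsDH (pilotDataOfK D K) logv).Packet j ((thetaIndex (pilotDataOfK D K)).over v)))
  (Ψ : ℤ → ∀ v : (thetaIndex (pilotDataOfK D K)).V, v ∈ (thetaIndex (pilotDataOfK D K)).Vbad →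
    Set ((logShellsDH (pilotDataOfK D K) logv).StarPacket v))
  (act : ℤ → ∀ v : (thetaIndex (pilotDataOfK D K)).V, v ∈ (thetaIndex (pilotDataOfK D K)).Vbad →
    (logShellsDH (pilotDataOfK D K) logv).StarPacket v → Module.End ℚ ((logShellsDH (pilotDataOfK D K) logv).StarPacket v))
  (Mmod : ℤ → ∀ j : (thetaIndex (pilotDataOfK D K)).LabelStar, Set ((logShellsDH (pilotDataOfK D K) logv).GlobalPacket j.1))
  (region : ℤ → ∀ j : (thetaIndex (pilotDataOfK D K)).LabelStar, FinDivisor M → ∀ vQ : (thetaIndex (pilotDataOfK D K)).VQ,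
    Set ((logShellsDH (pilotDataOfK D K) logv).Packet j.1 vQ))
  (n : ℤ) {HT : Type} {LogLink : HT → HT → Type} {IsFull : ∀ {s t : HT}, LogLink s t → Prop}
  (lat : LGPGaussianLogThetaLattice LogLink IsFull)
  {Frd : Type} {IsoF : Frd → Frd → Type} {Ob : Frd → Type} {realify : Frd → Frd} {Strip : Type}
  {IsoS : Strip → Strip → Type} {Mv : ∀ v : (thetaIndex (pilotDataOfK D K)).V, v ∈ (thetaIndex (pilotDataOfK D K)).Vbad → Type}
  [∀ v h, Monoid (Mv v h)]
  (sig : GlobalLGPFrobenioidSignature (thetaIndex (pilotDataOfK D K)).lstar (thetaIndex (pilotDataOfK D K)).V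
    (· ∈ (thetaIndex (pilotDataOfK D K)).Vbad) Frd IsoF Ob realify Strip IsoS Mv)
  (split : SplittingMonoids Mv) {ObΔ : Type} {N : ∀ v : (thetaIndex (pilotDataOfK D K)).V, v ∈ (thetaIndex (pilotDataOfK D K)).Vbad → Type}
  [∀ v h, Monoid (N v h)] (qData : QPilotData ObΔ N)
  (tq : ∀ (pp : Nat.Primes) (x : (thetaIndex (pilotDataOfK D K)).Fibre (.inr pp)),
    haveI : Fact (pp : ℕ).Prime := ⟨pp.2⟩; kOf (pilotDataOfK D K) pp.1 x)
  (t : ∀ (pp : Nat.Primes) (_ : Fin (pilotDataOfK D K).lstar) (x : (thetaIndex (pilotDataOfK D K)).Fibre (.inr pp)),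
    haveI : Fact (pp : ℕ).Prime := ⟨pp.2⟩; kOf (pilotDataOfK D K) pp.1 x)
  (htq0 : ∀ pp x, tq pp x ≠ 0)
  (htq1 : ∀ (pp : Nat.Primes) (x : (thetaIndex (pilotDataOfK D K)).Fibre (.inr pp)),
    haveI : Fact (pp : ℕ).Prime := ⟨pp.2⟩; placeOf (pilotDataOfK D K) pp.1 x ∉ (pilotDataOfK D K).S → ‖tq pp x‖ = 1)
  (col : ℤ → Column (logShellsDH (pilotDataOfK D K) logv))
  (ht0 : ∀ pp i x, t pp i x ≠ 0)
  (ht : ∀ (pp : Nat.Primes) (i : Fin (pilotDataOfK D K).lstar) (x : (thetaIndex (pilotDataOfK D K)).Fibre (.inr pp)),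
    haveI : Fact (pp : ℕ).Prime := ⟨pp.2⟩
    Real.log ‖t pp i x‖ = -((pilotDataOfK D K).thetaPilot i (placeOf (pilotDataOfK D K) pp.1 x)) *
      logNorm K (placeOf (pilotDataOfK D K) pp.1 x) / localDegree K (placeOf (pilotDataOfK D K) pp.1 x))
  (htq : ∀ (pp : Nat.Primes) (x : (thetaIndex (pilotDataOfK D K)).Fibre (.inr pp)),
    haveI : Fact (pp : ℕ).Prime := ⟨pp.2⟩
    Real.log ‖tq pp x‖ = -((pilotDataOfK D K).qPilot (placeOf (pilotDataOfK D K) pp.1 x)) *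
      logNorm K (placeOf (pilotDataOfK D K) pp.1 x) / localDegree K (placeOf (pilotDataOfK D K) pp.1 x))

include htq0 htq in
/-- **The real I06⋆-type cell of a REALISING q-idele in integer currency, at a tame bad place of the genuine datum**: with `‖t_{q,w}‖` realising
`P_q` (`‖t_{q,w}‖ = p^{−P_q(w)/e(w|p)}`, abc-iut-w5-d236 `norm_qIdele_eq_rpow_of_realises`), `P_q(w) = P ∈ ℕ`, `e(w|p) = e_p ≤ p − 2`, `p > 2`:
`t_{q,w} ∈ t_{q,w}^{N} · ℐ_{K_w} ⟺ (N − 1)·P ≤ e_p − 1` (part 1 §1 on rp-d2's window). [cite: DupuyHilado2025, §3.4]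
[cite: MochizukiAbsTopIII2015, Def 5.4 (iii) p. 126] [claim: Mochizuki2012, status: disputed] -/
theorem mem_pow_smul_logShell_qIdele_pilotDataOfK_iff_of_tame (pp : Nat.Primes) (w : (thetaIndex (pilotDataOfK D K)).Fibre (.inr pp))
    (hp2 : 2 < (pp : ℕ)) {e : ℕ} (hep : e ≤ (pp : ℕ) - 2)
    (hram : haveI : Fact (pp : ℕ).Prime := ⟨pp.2⟩; (placeOf (pilotDataOfK D K) pp.1 w).asIdeal.ramificationIdx ℤ = e)
    {P : ℕ} (hP : haveI : Fact (pp : ℕ).Prime := ⟨pp.2⟩; (pilotDataOfK D K).qPilot (placeOf (pilotDataOfK D K) pp.1 w) = P) (N : ℕ) :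
    haveI : Fact (pp : ℕ).Prime := ⟨pp.2⟩
    tq pp w ∈ tq pp w ^ N • logShell (PadicLogOnUnits.ofUnitLog (pp : ℕ) (kOf (pilotDataOfK D K) pp.1 w)) ↔
      ((N : ℤ) - 1) * (P : ℤ) ≤ (e : ℤ) - 1 := by
  haveI hF : Fact (pp : ℕ).Prime := ⟨pp.2⟩
  have heK : absRamificationIdx (pp : ℕ) (kOf (pilotDataOfK D K) pp.1 w) = e :=
    (absRamificationIdx_rescaledCompletion K (pp : ℕ) (placeOf (pilotDataOfK D K) pp.1 w)
      (natCast_mem_placeOf (pilotDataOfK D K) pp.1 w)).trans hram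
  have hew : absRamificationIdx (pp : ℕ) (kOf (pilotDataOfK D K) pp.1 w) ≤ (pp : ℕ) - 2 := heK.le.trans hep
  have hramF : (ramIdx K (placeOf (pilotDataOfK D K) pp.1 w) : ℝ) = (absRamificationIdx (pp : ℕ) (kOf (pilotDataOfK D K) pp.1 w) : ℝ) := by
    rw [ramIdx_eq K (placeOf (pilotDataOfK D K) pp.1 w), heK, hram]
  have hqh : ‖tq pp w‖ = ((pp : ℕ) : ℝ) ^ (-(((P : ℤ) : ℝ) / (absRamificationIdx (pp : ℕ) (kOf (pilotDataOfK D K) pp.1 w) : ℝ))) := by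
    rw [norm_qIdele_eq_rpow_of_realises (pilotDataOfK D K) tq htq0 htq pp w, hP, hramF, Int.cast_natCast, neg_div]
  rw [mem_pow_smul_logShell_iff_int_of_tame (pp : ℕ) (kOf (pilotDataOfK D K) pp.1 w) hp2 hew (htq0 pp w) hqh N, heK]

include ht0 ht htq in
/-- **THE (xi-f) LICENCE AT THE GENUINE `K`-LEVEL DATUM FROM THE REAL I06⋆ CELLS** (all bad fibres uniformly tame, REALISING ideles). For
Θ- and q-ideles realising the pilot divisors of `pilotDataOfK D K` ([IUTchI] Def. 3.1 initial Θ-data `D`): if every place `x` of `K` over a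
prime `p` below a bad place is tame with the same index `e(x|p) = e_p ≤ p − 2` (`p > 2`), and at every bad place `w | p` and every label
`j = i+1 ∈ 𝔽_l^⋇` the q-idele lies in the `j²`-power orbit of the real log-shell, `t_{q,w} ∈ t_{q,w}^{j²} · ℐ_{K_w}` (abc-iut-rp-d2's REAL I06⋆
cell), THEN abc-iut-c312-1's `Thm311ToCor312.Licence` holds at abc-iut-c312-7's `settingPrVolSharp (pilotDataOfK D K) …`. Route: the cell in
integer currency is `(j²−1)·P_w ≤ e_p − 1` ⟹ abc-iut-w5-d009's sufficient leg ⟹ its exact all-tame decision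
`licence_settingPrVolSharp_pilotDataOfK_iff_of_tame`. [cite: Mochizuki2012, IUTchI Ex. 3.2 (iv) p. 71; IUTchIV Prop. 1.2 (i)(ii) p. 10]
[cite: DupuyHilado2025, §3.3, §3.4, §4.9] [claim: Mochizuki2012, status: disputed] -/
theorem licence_settingPrVolSharp_pilotDataOfK_of_realStar_tame (e : Nat.Primes → ℕ)
    (htame : ∀ (pp : Nat.Primes) (x : (thetaIndex (pilotDataOfK D K)).Fibre (.inr pp)),
      haveI : Fact (pp : ℕ).Prime := ⟨pp.2⟩
      (∃ w : (thetaIndex (pilotDataOfK D K)).Fibre (.inr pp), placeOf (pilotDataOfK D K) pp.1 w ∈ (pilotDataOfK D K).S) →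
        2 < (pp : ℕ) ∧ e pp ≤ (pp : ℕ) - 2 ∧ (placeOf (pilotDataOfK D K) pp.1 x).asIdeal.ramificationIdx ℤ = e pp)
    (hstar : ∀ (pp : Nat.Primes) (i : Fin (pilotDataOfK D K).lstar) (w : (thetaIndex (pilotDataOfK D K)).Fibre (.inr pp)),
      haveI : Fact (pp : ℕ).Prime := ⟨pp.2⟩
      placeOf (pilotDataOfK D K) pp.1 w ∈ (pilotDataOfK D K).S →
        tq pp w ∈ tq pp w ^ (((i : ℕ) + 1) ^ 2) • logShell (PadicLogOnUnits.ofUnitLog (pp : ℕ) (kOf (pilotDataOfK D K) pp.1 w))) :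
    Thm311ToCor312.Licence
      (settingPrVolSharp (pilotDataOfK D K) hlog M archPk archSub Ψ act Mmod region n lat sig split qData tq t htq0 htq1) := by
  refine (licence_settingPrVolSharp_pilotDataOfK_iff_of_tame D hlog M archPk archSub Ψ act Mmod region n lat sig split qData tq t htq0
    htq1 ht0 ht htq e htame).2 fun pp i w hw P hP => ?_
  haveI hF : Fact (pp : ℕ).Prime := ⟨pp.2⟩
  obtain ⟨hp2, hep, hram⟩ := htame pp w ⟨w, hw⟩
  have he1 : (1 : ℤ) ≤ e pp := by
    have h0 := absRamificationIdx_pos (pp : ℕ) (kOf (pilotDataOfK D K) pp.1 w)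
    rw [(absRamificationIdx_rescaledCompletion K (pp : ℕ) (placeOf (pilotDataOfK D K) pp.1 w)
      (natCast_mem_placeOf (pilotDataOfK D K) pp.1 w)).trans hram] at h0
    exact_mod_cast h0
  have hle := (mem_pow_smul_logShell_qIdele_pilotDataOfK_iff_of_tame D tq htq0 htq pp w hp2 hep hram hP (((i : ℕ) + 1) ^ 2)).1
    (hstar pp i w hw)
  have hP0 : (0 : ℤ) ≤ (P : ℤ) := by positivity
  have hsuff : (((i : ℤ) + 1) ^ 2 - 1) * (P : ℤ) ≤ ((i : ℤ) + 1) * ((e pp : ℤ) - 1) := by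
    push_cast at hle
    nlinarith [hle, he1, hP0]
  have hex := tame_exact_of_sufficient_leg (e := (e pp : ℤ)) (j := (i : ℤ) + 1) (L := (i : ℤ) + 1) (P := (P : ℤ)) he1 hP0
    (by omega) le_rfl hsuff
  push_cast
  exact hex

include ht0 ht htq in
/-- **… hence BRANCH C's PER-DATUM S_H ANTECEDENT «∃ ρ qK, QPinned ∧ PilotKummerCompatHull» at the genuine `K`-level datum** (any columns
`col`; realising q-ideles have norm `≤ 1`, abc-iut-w5-d236 `norm_qIdele_le_one_of_realises`; abc-iut-w5-d009
`exists_qPinned_and_hull_settingPrVolSharp_iff_licence`). The per-datum form of the S_H hypothesis of the window certificates, reached from the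
I06⋆ column block on the tame stratum — the (k2) shape of plan/rescue/R-H/START-HERE.md §3. [cite: Mochizuki2012, IUTchI Ex. 3.2 (iv) p. 71;
IUTchIII Step (xi) (xi-f) p. 184] [cite: DupuyHilado2025, §3.3, §3.4, §4.9] [claim: Mochizuki2012, status: disputed] -/
theorem exists_qPinned_and_hull_settingPrVolSharp_pilotDataOfK_of_realStar_tame (e : Nat.Primes → ℕ)
    (htame : ∀ (pp : Nat.Primes) (x : (thetaIndex (pilotDataOfK D K)).Fibre (.inr pp)),
      haveI : Fact (pp : ℕ).Prime := ⟨pp.2⟩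
      (∃ w : (thetaIndex (pilotDataOfK D K)).Fibre (.inr pp), placeOf (pilotDataOfK D K) pp.1 w ∈ (pilotDataOfK D K).S) →
        2 < (pp : ℕ) ∧ e pp ≤ (pp : ℕ) - 2 ∧ (placeOf (pilotDataOfK D K) pp.1 x).asIdeal.ramificationIdx ℤ = e pp)
    (hstar : ∀ (pp : Nat.Primes) (i : Fin (pilotDataOfK D K).lstar) (w : (thetaIndex (pilotDataOfK D K)).Fibre (.inr pp)),
      haveI : Fact (pp : ℕ).Prime := ⟨pp.2⟩
      placeOf (pilotDataOfK D K) pp.1 w ∈ (pilotDataOfK D K).S →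
        tq pp w ∈ tq pp w ^ (((i : ℕ) + 1) ^ 2) • logShell (PadicLogOnUnits.ofUnitLog (pp : ℕ) (kOf (pilotDataOfK D K) pp.1 w))) :
    ∃ (ρ : (∀ v : (thetaIndex (pilotDataOfK D K)).V, v ∈ (thetaIndex (pilotDataOfK D K)).Vbad →
            Set ((logShellsDH (pilotDataOfK D K) logv).StarPacket v)) →
          ∀ (j : (thetaIndex (pilotDataOfK D K)).Label) (vQ : (thetaIndex (pilotDataOfK D K)).VQ),
            Set ((logShellsDH (pilotDataOfK D K) logv).Packet j vQ))
        (qK : ∀ v : (thetaIndex (pilotDataOfK D K)).V, v ∈ (thetaIndex (pilotDataOfK D K)).Vbad →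
          Set ((logShellsDH (pilotDataOfK D K) logv).StarPacket v)),
        QPinned ({ toSituation := situationPrVol (pilotDataOfK D K) hlog M archPk archSub Ψ act Mmod region, col := col } :
            LatticeSituation (thetaIndex (pilotDataOfK D K)))
          (settingPrVolSharp (pilotDataOfK D K) hlog M archPk archSub Ψ act Mmod region n lat sig split qData tq t htq0 htq1) ρ qK ∧
        PilotKummerCompatHull ({ toSituation := situationPrVol (pilotDataOfK D K) hlog M archPk archSub Ψ act Mmod region, col := col } :
            LatticeSituation (thetaIndex (pilotDataOfK D K)))
          (settingPrVolSharp (pilotDataOfK D K) hlog M archPk archSub Ψ act Mmod region n lat sig split qData tq t htq0 htq1) ρ qK :=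
  (exists_qPinned_and_hull_settingPrVolSharp_iff_licence (pilotDataOfK D K) hlog M archPk archSub Ψ act Mmod region n lat sig split qData
      tq t htq0 htq1 col (fun pp x => norm_qIdele_le_one_of_realises (pilotDataOfK D K) tq htq0 htq pp x)).2
    (licence_settingPrVolSharp_pilotDataOfK_of_realStar_tame D hlog M archPk archSub Ψ act Mmod region n lat sig split qData tq t htq0 htq1
      ht0 ht htq e htame hstar)

include ht0 ht htq in
/-- **CONVERSELY THE LICENCE AT THE GENUINE DATUM FORCES THE LINEAR SHELL CELLS**: under the same tameness / realising hypotheses,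
`Thm311ToCor312.Licence` at `settingPrVolSharp (pilotDataOfK D K) …` ⟹ `t_{q,w} ∈ t_{q,w}^{j} · ℐ_{K_w}` at every bad place `w` and every label
`j = i+1` (abc-iut-w5-d009's necessary leg `(j−1)·P_w ≤ e_p − 1`, read back through part 1 §1). [cite: DupuyHilado2025, §3.3, §3.4, §4.9]
[cite: MochizukiAbsTopIII2015, Def 5.4 (iii) p. 126] [claim: Mochizuki2012, status: disputed] -/
theorem realLinear_of_licence_settingPrVolSharp_pilotDataOfK_tame (e : Nat.Primes → ℕ)
    (htame : ∀ (pp : Nat.Primes) (x : (thetaIndex (pilotDataOfK D K)).Fibre (.inr pp)),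
      haveI : Fact (pp : ℕ).Prime := ⟨pp.2⟩
      (∃ w : (thetaIndex (pilotDataOfK D K)).Fibre (.inr pp), placeOf (pilotDataOfK D K) pp.1 w ∈ (pilotDataOfK D K).S) →
        2 < (pp : ℕ) ∧ e pp ≤ (pp : ℕ) - 2 ∧ (placeOf (pilotDataOfK D K) pp.1 x).asIdeal.ramificationIdx ℤ = e pp)
    (hL : Thm311ToCor312.Licence
      (settingPrVolSharp (pilotDataOfK D K) hlog M archPk archSub Ψ act Mmod region n lat sig split qData tq t htq0 htq1)) :
    ∀ (pp : Nat.Primes) (i : Fin (pilotDataOfK D K).lstar) (w : (thetaIndex (pilotDataOfK D K)).Fibre (.inr pp)),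
      haveI : Fact (pp : ℕ).Prime := ⟨pp.2⟩
      placeOf (pilotDataOfK D K) pp.1 w ∈ (pilotDataOfK D K).S →
        tq pp w ∈ tq pp w ^ ((i : ℕ) + 1) • logShell (PadicLogOnUnits.ofUnitLog (pp : ℕ) (kOf (pilotDataOfK D K) pp.1 w)) := by
  intro pp i w hw
  haveI hF : Fact (pp : ℕ).Prime := ⟨pp.2⟩
  obtain ⟨hp2, hep, hram⟩ := htame pp w ⟨w, hw⟩
  obtain ⟨P, hPspec⟩ := exists_nat_qPilot_pilotDataOfK D hw
  have hP := hPspec.1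
  have hall := (licence_settingPrVolSharp_pilotDataOfK_iff_of_tame D hlog M archPk archSub Ψ act Mmod region n lat sig split qData tq t
    htq0 htq1 ht0 ht htq e htame).1 hL pp i w hw P hP
  have he1 : (1 : ℤ) ≤ e pp := by
    have h0 := absRamificationIdx_pos (pp : ℕ) (kOf (pilotDataOfK D K) pp.1 w)
    rw [(absRamificationIdx_rescaledCompletion K (pp : ℕ) (placeOf (pilotDataOfK D K) pp.1 w)
      (natCast_mem_placeOf (pilotDataOfK D K) pp.1 w)).trans hram] at h0
    exact_mod_cast h0
  have hex : (e pp : ℤ) * ((((i : ℤ) + 1) ^ 2 * (P : ℤ) - 1) / e pp) + 1 - ((i : ℤ) + 1) * ((e pp : ℤ) - 1) ≤ (P : ℤ) := by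
    push_cast at hall
    exact hall
  have hnec := necessary_leg_of_tame_exact (e := (e pp : ℤ)) (L := (i : ℤ) + 1) (P := (P : ℤ)) he1 (by omega) hex
  refine (mem_pow_smul_logShell_qIdele_pilotDataOfK_iff_of_tame D tq htq0 htq pp w hp2 hep hram hP ((i : ℕ) + 1)).2 ?_
  push_cast
  linarith

end Summit.ABC.IUTFork.Repair.CandInternal2RealLabelsLicenceGenuineK

end
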